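import Summits.BirchSwinnertonDyer.Rank1Residual.GaloisImage.KolyvaginScalarTransport
import HarnessLib

/-!
# Automorphisms of `(ℤ/p^K)²` of `τ`-shape are conjugate (bridge B1, algebra half)
# (cell `b2b-bsdres`, team n1011, ROUTE-1 item R1-23: bridge (B1) between R23_endshape's
# ℕ-currency `Kato.IsKolyvaginProduct` + cyclicity flag and the datum currency of
# `Assembly.padicValRat_le_of_certificate_of_transport`; seat p18; file B1-alg)

HONEST FRAMING (verbatim for the cell): research route on the CONSTRUCTION-SHAPED class `X4` /
N11; prove what is provable now; nothing booked; no mark / label moved.  TOOL theorems of finite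
group theory only — no curve, no definition, no named fact.

Sakamoto's Kolyvagin primes relative to `τ` (`frobeniusClassPrimes ρ S τ N`, [S24] §2) are the
places whose Frobenius is CONJUGATE to `τ` on `T = E[3^K]` (and on `μ_{3^K}`); Kim's `𝒫_K`
([K22] §1.2.2, `Kato.IsKolyvaginPrime`) is given by congruences.  The bridge needs: two
automorphisms `u, u′` of `V ≅ (ℤ/p^K)²` which both satisfy (H.2) `V/(u − 1)V ≅ ℤ/p^K` and both
preserve a non-degenerate alternating pairing (the Weil pairing — "`det = 1`") are conjugate in
`Aut(V)` (`exists_addEquiv_conj`).  Intrinsic proof: for such `u`, `M = u − 1`, `I = M(V)`,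
`V₀ = ker M` have `#I = #V₀ = p^K`; `V/I` cyclic forces `I ⊄ V[p^{K−1}]`
(`exists_mem_nsmul_ne_zero`), so `I = ⟨x⟩`, `x` of order `p^K`; invariance gives `e(V₀, I) = 1`,
and the annihilator of `x` has at most `p^K` elements (the character `e(·, x)` takes `≥ p^K`
values by non-degeneracy), so `V₀ = I`: `M² = 0` (`sq_eq_zero_and_exists_addOrderOf_eq`).  Two
square-zero `M, M′` with values `Mw`, `M′w′` of order `p^K` are conjugate by the automorphism
matching the frames `(Mw, w)`, `(M′w′, w′)` (`exists_addEquiv_conj_of_sq_eq_zero`).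

References: R. Sakamoto, Math. Ann. (2024) §2, the set `𝒫` and (H.2) [Sakamoto2024]; B. Mazur,
K. Rubin, Mem. AMS 799 (2004) §3.5 [MazurRubin2004]; C.-H. Kim, AJM 148 (2026) §1.2.2
[Kim2022StructureSelmer].
-/
namespace Summit.BirchSwinnertonDyer.Rank1Residual.GaloisImage.Unipotent

variable {V : Type*} [AddCommGroup V]

/-! ## Frames `(a, b) ↦ a•x + b•w` -/

/-- The additive map `ℤ/N × ℤ/N → V`, `(a, b) ↦ a•x + b•w`, for `x, w` killed by `N`. [folklore] -/
theorem exists_frameHom {N : ℕ} [NeZero N] (x w : V) (hx : N • x = 0) (hw : N • w = 0) :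
    ∃ f : ZMod N × ZMod N →+ V, ∀ a b : ZMod N, f (a, b) = a.val • x + b.val • w := by
  refine ⟨AddMonoidHom.mk' (fun ab => ab.1.val • x + ab.2.val • w) ?_, fun a b => rfl⟩
  rintro ⟨a, b⟩ ⟨a', b'⟩
  change (a + a').val • x + (b + b').val • w = (a.val • x + b.val • w) + (a'.val • x + b'.val • w)
  rw [ZMod.val_add, ZMod.val_add, ← nsmul_eq_mod_nsmul _ hx, ← nsmul_eq_mod_nsmul _ hw,
    add_nsmul, add_nsmul]
  abel

/-- A frame `(Mw, w)` with `M² = 0` and `Mw` of order `N` is injective: `a•Mw + b•w = 0 ⟹ a = b = 0`.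
[folklore] -/
theorem frame_injective {N : ℕ} [NeZero N] (M : V →+ V) (hM : ∀ v, M (M v) = 0) {w : V}
    (hw : addOrderOf (M w) = N)
    (f : ZMod N × ZMod N →+ V) (hf : ∀ a b : ZMod N, f (a, b) = a.val • M w + b.val • w) :
    Function.Injective f := by
  refine (injective_iff_map_eq_zero f).2 fun ab hab => ?_
  obtain ⟨a, b⟩ := ab
  rw [hf] at hab
  -- apply `M`: `b • Mw = 0`, so `b = 0`
  have hb : b.val • M w = 0 := by
    have h := congrArg M hab
    rwa [map_add, map_nsmul, map_nsmul, hM, smul_zero, zero_add, map_zero] at h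
  have hb0 : b = 0 := by
    have hdvd : N ∣ b.val := by
      have h := addOrderOf_dvd_of_nsmul_eq_zero hb
      rwa [hw] at h
    have := Nat.eq_zero_of_dvd_of_lt hdvd (ZMod.val_lt b)
    exact (ZMod.val_eq_zero b).1 this
  rw [hb0, ZMod.val_zero, zero_smul, add_zero] at hab
  have ha0 : a = 0 := by
    have hdvd : N ∣ a.val := by
      have h := addOrderOf_dvd_of_nsmul_eq_zero hab
      rwa [hw] at h
    exact (ZMod.val_eq_zero a).1 (Nat.eq_zero_of_dvd_of_lt hdvd (ZMod.val_lt a))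
  rw [ha0, hb0]
  rfl

/-- Such a frame is bijective when `#V = N²`. [folklore] -/
theorem frame_bijective {N : ℕ} [NeZero N] [Finite V] (hcard : Nat.card V = N ^ 2)
    (M : V →+ V) (hM : ∀ v, M (M v) = 0) {w : V} (hw : addOrderOf (M w) = N)
    (f : ZMod N × ZMod N →+ V) (hf : ∀ a b : ZMod N, f (a, b) = a.val • M w + b.val • w) :
    Function.Bijective f := by
  classical
  letI : Fintype V := Fintype.ofFinite V
  refine (Fintype.bijective_iff_injective_and_card f).2 ⟨frame_injective M hM hw f hf, ?_⟩
  rw [Fintype.card_prod, ZMod.card, ← Nat.card_eq_fintype_card, hcard, pow_two]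

/-! ## Conjugacy of square-zero endomorphisms with a full-order value -/

/-- **Two endomorphisms `M, M′` of a finite abelian group of order `N²` killed by `N`, with
`M² = M′² = 0` and values `Mw`, `M′w′` of order `N`, are conjugate under `Aut(V)`**: the
automorphism carrying the frame `(Mw, w)` to `(M′w′, w′)` does it. [folklore] -/
theorem exists_addEquiv_conj_of_sq_eq_zero {N : ℕ} [NeZero N] [Finite V] (hcard : Nat.card V = N ^ 2)
    (hN : ∀ v : V, N • v = 0) (M M' : V →+ V) (hM : ∀ v, M (M v) = 0) (hM' : ∀ v, M' (M' v) = 0)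
    {w w' : V} (hw : addOrderOf (M w) = N) (hw' : addOrderOf (M' w') = N) :
    ∃ γ : V ≃+ V, ∀ v, γ (M v) = M' (γ v) := by
  obtain ⟨f, hf⟩ := exists_frameHom (N := N) (M w) w (hN _) (hN _)
  obtain ⟨f', hf'⟩ := exists_frameHom (N := N) (M' w') w' (hN _) (hN _)
  have hbij := frame_bijective hcard M hM hw f hf
  have hbij' := frame_bijective hcard M' hM' hw' f' hf'
  let F : ZMod N × ZMod N ≃+ V := AddEquiv.ofBijective f hbij
  let F' : ZMod N × ZMod N ≃+ V := AddEquiv.ofBijective f' hbij'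
  refine ⟨F.symm.trans F', fun v => ?_⟩
  obtain ⟨⟨a, b⟩, rfl⟩ := F.surjective v
  -- `M (F (a, b)) = F (b, 0)` and likewise for `M′`
  have hMF : M (F (a, b)) = F (b, 0) := by
    change M (f (a, b)) = f (b, 0)
    rw [hf, hf, map_add, map_nsmul, map_nsmul, hM, smul_zero, zero_add, ZMod.val_zero, zero_smul,
      add_zero]
  have hMF' : M' (F' (a, b)) = F' (b, 0) := by
    change M' (f' (a, b)) = f' (b, 0)
    rw [hf', hf', map_add, map_nsmul, map_nsmul, hM', smul_zero, zero_add, ZMod.val_zero, zero_smul,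
      add_zero]
  rw [hMF, AddEquiv.trans_apply, AddEquiv.trans_apply, AddEquiv.symm_apply_apply,
    AddEquiv.symm_apply_apply, hMF']

/-! ## The `τ`-shape from (H.2) and an invariant alternating pairing -/

/-- Consequences of a frame `V ≅ (ℤ/N)²`: `N` kills `V` and `#V = N²`. [folklore] -/
theorem nsmul_eq_zero_and_card_of_frame {N : ℕ} (F : ZMod N × ZMod N ≃+ V) :
    (∀ v : V, N • v = 0) ∧ Nat.card V = N ^ 2 := by
  have hNz : ∀ z : ZMod N × ZMod N, N • z = 0 := fun z =>
    Prod.ext (show N • z.1 = 0 by rw [nsmul_eq_mul, ZMod.natCast_self, zero_mul])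
      (show N • z.2 = 0 by rw [nsmul_eq_mul, ZMod.natCast_self, zero_mul])
  refine ⟨fun v => ?_, ?_⟩
  · rw [← F.apply_symm_apply v, ← map_nsmul, hNz, map_zero]
  · rw [← Nat.card_congr F.toEquiv, Nat.card_prod, Nat.card_zmod, pow_two]

/-- In an additive group, if `p • y = 0` (`p` prime) and `x ≠ 0` is a multiple of `y`, then `x` and
`y` generate the same cyclic subgroup. [folklore] -/
theorem zmultiples_eq_of_mem_of_ne_zero {p : ℕ} [hp : Fact p.Prime] {x y : V} (hy : p • y = 0)
    (hx : x ∈ AddSubgroup.zmultiples y) (hx0 : x ≠ 0) :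
    AddSubgroup.zmultiples x = AddSubgroup.zmultiples y := by
  have hy0 : y ≠ 0 := by
    rintro rfl
    rw [AddSubgroup.zmultiples_zero_eq_bot, AddSubgroup.mem_bot] at hx
    exact hx0 hx
  have hoy : addOrderOf y = p := addOrderOf_eq_prime hy hy0
  have hpx : p • x = 0 := by
    obtain ⟨k, rfl⟩ := AddSubgroup.mem_zmultiples_iff.mp hx
    rw [smul_comm, hy, smul_zero]
  have hox : addOrderOf x = p := addOrderOf_eq_prime hpx hx0
  haveI : Finite (AddSubgroup.zmultiples y) :=
    Nat.finite_of_card_ne_zero (by rw [Nat.card_zmultiples, hoy]; exact hp.out.ne_zero)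
  exact AddSubgroup.eq_of_le_of_card_ge (AddSubgroup.zmultiples_le_of_mem hx)
    (by rw [Nat.card_zmultiples, Nat.card_zmultiples, hox, hoy])

/-- `p^{K-1} ≠ 0` in `ℤ/p^K` (`K ≥ 1`). [folklore] -/
theorem natCast_pow_pred_ne_zero {p K : ℕ} [hp : Fact p.Prime] (hK : 0 < K) :
    ((p ^ (K - 1) : ℕ) : ZMod (p ^ K)) ≠ 0 := by
  rw [Ne, ZMod.natCast_eq_zero_iff]
  intro h
  have h1 := Nat.le_of_dvd (pow_pos hp.out.pos _) h
  have h2 : p ^ (K - 1) < p ^ K := Nat.pow_lt_pow_right hp.out.one_lt (by omega)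
  omega

/-- **A subgroup `I` of `V ≅ (ℤ/p^K)²` with CYCLIC quotient `V/I` contains an element not killed by
`p^{K−1}`** (else multiplication by `p^{K−1}` would factor through the cyclic group `V/I`, but
its image `V[p] ≅ (ℤ/p)²` is not cyclic). [folklore] -/
theorem exists_mem_nsmul_ne_zero {p K : ℕ} [hp : Fact p.Prime] (hK : 0 < K)
    (F : ZMod (p ^ K) × ZMod (p ^ K) ≃+ V) (I : AddSubgroup V) [hI : IsAddCyclic (V ⧸ I)] :
    ∃ x ∈ I, p ^ (K - 1) • x ≠ 0 := by
  rcases em (∃ x ∈ I, p ^ (K - 1) • x ≠ 0) with h | h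
  · exact h
  exfalso
  have hcon : ∀ x ∈ I, p ^ (K - 1) • x = 0 := fun x hx => by
    rcases em (p ^ (K - 1) • x = 0) with h0 | h0
    · exact h0
    · exact absurd ⟨x, hx, h0⟩ h
  -- a generator of `V ⧸ I`, lifted to `v₀`; `y := p^{K-1} • v₀` is killed by `p`
  obtain ⟨g, hg⟩ := IsAddCyclic.exists_generator (α := V ⧸ I)
  obtain ⟨v₀, hv₀⟩ := QuotientAddGroup.mk_surjective g
  have hpK : p ^ (K - 1) * p = p ^ K := by
    rw [← pow_succ, Nat.sub_add_cancel hK]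
  have hNv := (nsmul_eq_zero_and_card_of_frame F).1
  have hy : p • (p ^ (K - 1) • v₀) = 0 := by rw [← mul_nsmul, hpK, hNv]
  -- every `p^{K-1} • v` is a multiple of `y`
  have hmul : ∀ v : V, p ^ (K - 1) • v ∈ AddSubgroup.zmultiples (p ^ (K - 1) • v₀) := by
    intro v
    obtain ⟨m, hm⟩ := hg (QuotientAddGroup.mk v : V ⧸ I)
    change m • g = (QuotientAddGroup.mk v : V ⧸ I) at hm
    rw [← hv₀, ← QuotientAddGroup.mk_zsmul, QuotientAddGroup.eq] at hm
    -- `-(m • v₀) + v ∈ I`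
    have h0 := hcon _ hm
    rw [nsmul_add, smul_neg, neg_add_eq_zero] at h0
    refine AddSubgroup.mem_zmultiples_iff.mpr ⟨m, ?_⟩
    rw [← h0, smul_comm]
  -- the two elements `x₁ = F (p^{K-1}, 0)`, `x₂ = F (0, p^{K-1})`
  set c : ZMod (p ^ K) := ((p ^ (K - 1) : ℕ) : ZMod (p ^ K)) with hc
  have hc0 : c ≠ 0 := natCast_pow_pred_ne_zero hK
  have hx₁ : p ^ (K - 1) • F (1, 0) = F (c, 0) := by
    rw [← map_nsmul]
    congr 1
    ext <;> simp [hc, nsmul_eq_mul]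
  have hx₂ : p ^ (K - 1) • F (0, 1) = F (0, c) := by
    rw [← map_nsmul]
    congr 1
    ext <;> simp [hc, nsmul_eq_mul]
  have hx₁0 : F (c, 0) ≠ 0 := by
    intro h0
    have := F.injective (h0.trans (map_zero F).symm)
    exact hc0 (congrArg Prod.fst this)
  have h1 := hmul (F (1, 0))
  have h2 := hmul (F (0, 1))
  rw [hx₁] at h1
  rw [hx₂] at h2
  rw [← zmultiples_eq_of_mem_of_ne_zero (p := p) hy h1 hx₁0] at h2
  obtain ⟨k, hk⟩ := AddSubgroup.mem_zmultiples_iff.mp h2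
  rw [← map_zsmul] at hk
  have hk' := congrArg Prod.snd (F.injective hk)
  change k • (0 : ZMod (p ^ K)) = c at hk'
  rw [smul_zero] at hk'
  exact hc0 hk'.symm

/-- **The `τ`-shape.**  `V ≅ (ℤ/p^K)²` (`K ≥ 1`), `u ∈ Aut(V)` with (H.2) `V/(u − 1)V ≅ ℤ/p^K`,
preserving a non-degenerate alternating pairing into the `p^K`-th roots of unity of a field (the
Weil pairing; "`det = 1`"): then `M := u − 1` has `M² = 0` and a value `Mw` of order `p^K` — the
shape `(1 1; 0 1)` (module docstring for the intrinsic proof).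
[cite: Sakamoto2024, §2 (H.2) (p. 921)] [cite: MazurRubin2004, §3.5] -/
theorem sq_eq_zero_and_exists_addOrderOf_eq {p K : ℕ} [hp : Fact p.Prime] (hK : 0 < K) [Finite V]
    (F : ZMod (p ^ K) × ZMod (p ^ K) ≃+ V) (u : V ≃+ V)
    (hcoker : Nonempty (V ⧸ (u.toAddMonoidHom - AddMonoidHom.id V).range ≃+ ZMod (p ^ K)))
    {L : Type*} [Field L] (e : V → V → L) (hpow : ∀ S T, e S T ^ (p ^ K) = 1)
    (haddl : ∀ S₁ S₂ T, e (S₁ + S₂) T = e S₁ T * e S₂ T)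
    (haddr : ∀ S T₁ T₂, e S (T₁ + T₂) = e S T₁ * e S T₂)
    (halt : ∀ T, e T T = 1) (hnd : ∀ T, (∀ S, e S T = 1) → T = 0)
    (hinv : ∀ S T, e (u S) (u T) = e S T) :
    (∀ v, (u.toAddMonoidHom - AddMonoidHom.id V) ((u.toAddMonoidHom - AddMonoidHom.id V) v) = 0) ∧
      ∃ w, addOrderOf ((u.toAddMonoidHom - AddMonoidHom.id V) w) = p ^ K := by
  classical
  set M := u.toAddMonoidHom - AddMonoidHom.id V with hMdef
  have hMv : ∀ v, M v = u v - v := fun v => rfl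
  haveI : NeZero (p ^ K) := ⟨pow_ne_zero _ hp.out.ne_zero⟩
  obtain ⟨q⟩ := hcoker
  -- frame facts
  obtain ⟨hNv, hcardV⟩ := nsmul_eq_zero_and_card_of_frame F
  -- `#(V/I) = p^K`, so `#I = p^K` and `#V₀ = p^K`
  have hcardQ : Nat.card (V ⧸ M.range) = p ^ K := by
    rw [Nat.card_congr q.toEquiv, Nat.card_zmod]
  have hcardI : Nat.card M.range = p ^ K := by
    have h := M.range.card_eq_card_quotient_mul_card_addSubgroup
    rw [hcardV, hcardQ, pow_two] at h
    exact (Nat.eq_of_mul_eq_mul_left (pow_pos hp.out.pos K) h).symm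
  have hcardK : Nat.card M.ker = p ^ K := by
    have h := M.ker.card_eq_card_quotient_mul_card_addSubgroup
    rw [Nat.card_congr (QuotientAddGroup.quotientKerEquivRange M).toEquiv, hcardI, hcardV,
      pow_two] at h
    exact (Nat.eq_of_mul_eq_mul_left (pow_pos hp.out.pos K) h).symm
  -- `I = ⟨x⟩` with `x` of order `p^K`
  haveI : IsAddCyclic (V ⧸ M.range) :=
    isAddCyclic_of_surjective q.symm.toAddMonoidHom q.symm.surjective
  obtain ⟨x, hxI, hx⟩ := exists_mem_nsmul_ne_zero hK F M.range
  have hox : addOrderOf x = p ^ K := by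
    obtain ⟨j, hj, hjx⟩ := (Nat.dvd_prime_pow hp.out).1 (addOrderOf_dvd_of_nsmul_eq_zero (hNv x))
    rw [hjx]
    rcases Nat.lt_or_ge j K with hlt | hge
    · exfalso
      apply hx
      have hdvd : addOrderOf x ∣ p ^ (K - 1) := by
        rw [hjx]; exact pow_dvd_pow p (by omega)
      exact addOrderOf_dvd_iff_nsmul_eq_zero.mp hdvd
    · rw [le_antisymm hj hge]
  haveI : Finite M.range :=
    Nat.finite_of_card_ne_zero (by rw [hcardI]; exact pow_ne_zero _ hp.out.ne_zero)
  have hIx : M.range = AddSubgroup.zmultiples x := by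
    symm
    exact AddSubgroup.eq_of_le_of_card_ge (AddSubgroup.zmultiples_le_of_mem hxI)
      (by rw [Nat.card_zmultiples, hox, hcardI])
  obtain ⟨w, hw⟩ : ∃ w, M w = x := hxI
  -- values of `e` are non-zero
  have hne : ∀ S T, e S T ≠ 0 := fun S T h0 => by
    have := hpow S T
    rw [h0, zero_pow (pow_ne_zero _ hp.out.ne_zero)] at this
    exact zero_ne_one this
  -- invariance: `e(S, M T) = 1` for `S ∈ ker M`
  have horth : ∀ S, M S = 0 → ∀ T, e S (M T) = 1 := by
    intro S hS T
    have huS : u S = S := by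
      have := hMv S; rw [hS] at this; exact (sub_eq_zero.mp this.symm)
    have h1 : e S (u T) = e S (M T) * e S T := by
      have hT : M T + T = u T := by rw [hMv]; abel
      rw [← hT, haddr]
    have h2 : e S (u T) = e S T := by rw [← hinv S T, huS]
    rw [h2] at h1
    exact (mul_eq_right₀ (hne S T)).mp h1.symm
  -- the character `S ↦ e(S, x)` as a hom into `Lˣ`; its kernel `X`
  let χ : V →+ Additive Lˣ := AddMonoidHom.mk' (fun S => Additive.ofMul (Units.mk0 (e S x) (hne S x)))
    (fun S₁ S₂ => by
      apply Additive.toMul.injective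
      apply Units.ext
      simp [haddl])
  have hχ : ∀ S, χ S = 0 ↔ e S x = 1 := fun S => by
    constructor
    · intro h
      have := congrArg (fun t => ((Additive.toMul t : Lˣ) : L)) h
      simpa [χ] using this
    · intro h
      apply Additive.toMul.injective
      apply Units.ext
      simpa [χ] using h
  -- multiples in either argument
  have hzero_right : ∀ S, e S 0 = 1 := fun S => by
    have h := haddr S 0 0
    rw [add_zero] at h
    exact (mul_eq_left₀ (hne S 0)).mp h.symm
  have hnsmul_right : ∀ (a : ℕ) S T, e S (a • T) = e S T ^ a := fun a S T => by
    induction a with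
    | zero => rw [zero_nsmul, pow_zero, hzero_right]
    | succ a ih => rw [succ_nsmul, haddr, ih, pow_succ]
  have hzero_left : ∀ T, e 0 T = 1 := fun T => by
    have h := haddl 0 0 T
    rw [add_zero] at h
    exact (mul_eq_left₀ (hne 0 T)).mp h.symm
  have hnsmul_left : ∀ (a : ℕ) S T, e (a • S) T = e S T ^ a := fun a S T => by
    induction a with
    | zero => rw [zero_nsmul, pow_zero, hzero_left]
    | succ a ih => rw [succ_nsmul, haddl, ih, pow_succ]
  -- the image of `χ` has at least `p^K` elements: it is a `p`-group not killed by `p^{K-1}`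
  haveI : Finite χ.range := Finite.of_surjective χ.rangeRestrict χ.rangeRestrict_surjective
  have hrange : p ^ K ≤ Nat.card χ.range := by
    have hkill : ∀ t : χ.range, p ^ K • t = 0 := fun t => by
      obtain ⟨t, S, rfl⟩ := t
      apply Subtype.ext
      change p ^ K • χ S = 0
      rw [← map_nsmul, hNv, map_zero]
    obtain ⟨j, hj⟩ := Transport.exists_natCard_eq_pow_of_nsmul_eq_zero (p := p) hkill
    rw [hj]
    rcases Nat.lt_or_ge j K with hlt | hge
    · exfalso
      apply hx
      refine hnd _ fun S => ?_
      -- `p^{K-1}` kills the image of `χ`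
      have ht : p ^ (K - 1) • (⟨χ S, S, rfl⟩ : χ.range) = 0 := by
        have h0 : p ^ j • (⟨χ S, S, rfl⟩ : χ.range) = 0 := by rw [← hj]; exact card_nsmul_eq_zero'
        obtain ⟨c, hc⟩ : p ^ j ∣ p ^ (K - 1) := pow_dvd_pow p (by omega)
        have hcc : (p ^ j * c) • (⟨χ S, S, rfl⟩ : χ.range) = c • (p ^ j • (⟨χ S, S, rfl⟩ : χ.range)) := by
          rw [← mul_nsmul, mul_comm]
        rw [hc, hcc, h0, smul_zero]
      have ht' : χ (p ^ (K - 1) • S) = 0 := by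
        rw [map_nsmul]
        exact congrArg Subtype.val ht
      rw [hχ, hnsmul_left] at ht'
      rw [hnsmul_right]
      exact ht'
    · exact Nat.pow_le_pow_right hp.out.pos hge
  -- so `#ker χ ≤ p^K`
  have hker : Nat.card χ.ker ≤ p ^ K := by
    have h := χ.ker.card_eq_card_quotient_mul_card_addSubgroup
    rw [Nat.card_congr (QuotientAddGroup.quotientKerEquivRange χ).toEquiv, hcardV, pow_two] at h
    by_contra hlt
    have : p ^ K * p ^ K < Nat.card χ.range * Nat.card χ.ker :=
      Nat.mul_lt_mul_of_le_of_lt hrange (not_le.mp hlt) (lt_of_lt_of_le (pow_pos hp.out.pos K) hrange)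
    omega
  -- `I ≤ ker χ` (alternating) and `V₀ ≤ ker χ` (invariance)
  have hIle : M.range ≤ χ.ker := by
    rw [hIx]
    intro S hS
    obtain ⟨k, rfl⟩ := AddSubgroup.mem_zmultiples_iff.mp hS
    rw [AddMonoidHom.mem_ker, map_zsmul]
    have hx0 : χ x = 0 := (hχ x).2 (halt x)
    rw [hx0, smul_zero]
  have hKle : M.ker ≤ χ.ker := fun S hS => by
    rw [AddMonoidHom.mem_ker, hχ, ← hw]
    exact horth S hS w
  haveI : Finite χ.ker := inferInstance
  have hIeq : M.range = χ.ker := AddSubgroup.eq_of_le_of_card_ge hIle (by rw [hcardI]; exact hker)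
  haveI : Finite M.ker := inferInstance
  have hKeq : M.ker = M.range :=
    AddSubgroup.eq_of_le_of_card_ge (hIeq ▸ hKle) (by rw [hcardI, hcardK])
  refine ⟨fun v => ?_, w, by rw [hw, hox]⟩
  have hv : M v ∈ M.ker := by rw [hKeq]; exact ⟨v, rfl⟩
  exact hv

/-- **Conjugacy of `τ`-shaped automorphisms** (bridge B1, algebra half): `u, u′ ∈ Aut(V)`,
`V ≅ (ℤ/p^K)²`, both with (H.2) and both preserving a non-degenerate alternating pairing into the
`p^K`-th roots of unity of a field, are conjugate: `γ u = u′ γ`.  (With `u = ρ(Frob_ℓ)`, `u′ = ρ(τ)`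
on `E[3^K]`, the Weil pairing and `ρ` onto `Aut(E[3^K])`: a prime of Kim's `𝒫_K` with the cyclicity
flag lies in Sakamoto's `τ`-class.) [cite: Sakamoto2024, §2 (H.2) and the set 𝒫 (pp. 920–921)] -/
theorem exists_addEquiv_conj {p K : ℕ} [hp : Fact p.Prime] (hK : 0 < K) [Finite V]
    (F : ZMod (p ^ K) × ZMod (p ^ K) ≃+ V)
    {L : Type*} [Field L] (e : V → V → L) (hpow : ∀ S T, e S T ^ (p ^ K) = 1)
    (haddl : ∀ S₁ S₂ T, e (S₁ + S₂) T = e S₁ T * e S₂ T)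
    (haddr : ∀ S T₁ T₂, e S (T₁ + T₂) = e S T₁ * e S T₂)
    (halt : ∀ T, e T T = 1) (hnd : ∀ T, (∀ S, e S T = 1) → T = 0)
    (u u' : V ≃+ V)
    (hu : Nonempty (V ⧸ (u.toAddMonoidHom - AddMonoidHom.id V).range ≃+ ZMod (p ^ K)))
    (hu' : Nonempty (V ⧸ (u'.toAddMonoidHom - AddMonoidHom.id V).range ≃+ ZMod (p ^ K)))
    (hinv : ∀ S T, e (u S) (u T) = e S T) (hinv' : ∀ S T, e (u' S) (u' T) = e S T) :
    ∃ γ : V ≃+ V, ∀ v, γ (u v) = u' (γ v) := by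
  haveI : NeZero (p ^ K) := ⟨pow_ne_zero _ hp.out.ne_zero⟩
  obtain ⟨hM, w, hw⟩ := sq_eq_zero_and_exists_addOrderOf_eq hK F u hu e hpow haddl haddr halt hnd hinv
  obtain ⟨hM', w', hw'⟩ :=
    sq_eq_zero_and_exists_addOrderOf_eq hK F u' hu' e hpow haddl haddr halt hnd hinv'
  obtain ⟨hNv, hcardV⟩ := nsmul_eq_zero_and_card_of_frame F
  obtain ⟨γ, hγ⟩ := exists_addEquiv_conj_of_sq_eq_zero hcardV hNv _ _ hM hM' hw hw'
  refine ⟨γ, fun v => ?_⟩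
  have h := hγ v
  change γ (u v - v) = u' (γ v) - γ v at h
  rw [map_sub] at h
  exact sub_left_injective h

end Summit.BirchSwinnertonDyer.Rank1Residual.GaloisImage.Unipotent
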